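import Summits.Ventures.LatticeQCDFlow.Scaling.RefreshThenProposeMixing
import Summits.Ventures.LatticeQCDFlow.Scaling.DominatedStarGapAndMixing

/-!
HONEST FRAMING: exact (Metropolis-corrected) sampling algorithms for lattice gauge theory; figures
of merit are autocorrelation/cost numbers at stated couplings and volumes; no continuum-physics
claim.

# RefreshThenProposeRelaxation — THE REFRESH-THEN-PROPOSE TEMPERING STAR AT UNIFORM WEIGHTS: `γ⋆ ≥ p/K`, `t_rel ≤ K/p`, IRREDUCIBILITY,
# `Gap ≥ p/K`, AND THE HONEST SAMPLE SIZE FROM EVERY START — BURN-IN `⌈(K/p)·log(2K/ε)⌉`, RUN `(4Var/(η²ε))·(K/p)` — VOLUME-FREE,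
# POLYNOMIAL IN `K` (lean-2 GEN-28, ours)

Venture-side (OURS).  Cell `lqcd-flow` (pub-lqcd), unit `pub-lqcd-lean-2-g28`, 2026-08-28.  Chapter N, file 22: the geometric distance profile
`d(n) ≤ K(1 − p/K)ⁿ` of `Scaling/RefreshThenProposeMixing` (N21) bounds every non-trivial eigenvalue (`Scaling/DominatedStarGapAndMixing` §0,
chapter M: `d(n) ≤ Cρⁿ` for all `n` ⇒ `λ⋆ ≤ ρ`), so the refresh-then-propose star — a fresh hot draw before every map-assisted proposal, levels
chosen uniformly, one-sided domination `p·μ_k(φ_k u) ≤ μ_0(u)` — has absolute spectral gap `≥ p/K` and relaxation time `≤ K/p`: the same order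
as the persistent hub's quadratic theory (`Scaling/DominatedStarRegimeFreeGap`: `Gap ≥ p·min{ct/(3m), (1−t)w_0/(7K)}`), with the constant `1`.

## What is proved

* **`refreshThenPropose_worstTvDist_le_geom`** — uniform weights: `d(n) ≤ K·(1 − p/K)ⁿ`.
* **`refreshThenPropose_absSpectralGap_ge`** — `γ⋆ ≥ p/K`; **`refreshThenPropose_relaxationTime_le`** — `t_rel ≤ K/p`.
* **`refreshThenPropose_worstTvDist_le_eps`** (`d(⌈(K/p)log(K/ε)⌉) ≤ ε`), **`refreshThenPropose_isIrreducible`**, **`refreshThenPropose_spectralGap_ge`**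
  (`Gap ≥ p/K`), **`refreshThenPropose_timeAverage`** — from EVERY start: burn-in `r ≥ ⌈(K/p)·log(2K/ε)⌉`, run `N ≥ (4Var_π̃(f)/(η²ε))·(K/p)` ⇒
  deviation probability `≤ ε` (Levin–Peres–Wilmer Thm 12.21, typed in the tree).

Reading (no numerics implied): per (hot draw + swap test) pair the refresh-then-propose star relaxes at rate `≥ p/K`; the persistent hub at
half swaps relaxes at rate `≥ p/(14K)` per step with one hot draw per `≈ 2` steps — the same order in both currencies, so the open item 1 is
about the cold-start logarithm only, not about relaxation; and the refresh-then-propose design has a COMPLETE volume-free recipe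
(`(K/p)·log(2K/ε)` burn-in, `(4Var/(η²ε))·(K/p)` run), which the persistent hub has on record only for `K = 1` (`Scaling/TwoLevelRegimeFreeSampleSize`).  NOT CLAIMED: anything measured.  Literature grade (cell rule): OWN COMPOSITION on
N21 and chapter M's §0; nothing cited as a fact; no new bib keys.
-/

noncomputable section

open Finset Function Matrix
open Literature.Probability.MarkovChains

namespace Summit.Ventures.LatticeQCDFlow.Scaling

variable {S : Type*} [Fintype S] [DecidableEq S] {K : ℕ} {μ : Fin (K + 1) → S → ℝ} {p : ℝ}

section Refresh
variable (φ : Fin K → Equiv.Perm S)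

/-- **`d(n) ≤ K·(1 − p/K)ⁿ` at uniform weights** for the refresh-then-propose star. [ours] -/
theorem refreshThenPropose_worstTvDist_le_geom [Nonempty S] (hK : 1 ≤ K) (hμ : ∀ k x, 0 < μ k x) (hμ1 : ∀ k, ∑ u, μ k u = 1)
    (hp : 0 < p) (hp1 : p ≤ 1) (hdom : ∀ (k : Fin K) (u : S), p * μ k.succ (φ k u) ≤ μ 0 u) (n : ℕ) :
    worstTvDist (prodKernel (fun _ : Fin K => (1 : ℝ) / K) (fun k : Fin K => mhKernel (fun _ z : S => μ 0 ((φ k).symm z)) (μ k.succ)))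
        (tensorFun (fun k : Fin K => μ k.succ)) n ≤ K * (1 - p / K) ^ n := by
  have hKpos : (0 : ℝ) < K := Nat.cast_pos.mpr (by omega)
  have h := refreshThenPropose_worstTvDist_le φ hK hμ hμ1 hp hp1 hdom (w' := fun _ : Fin K => (1 : ℝ) / K)
    (fun _ => by positivity) (by rw [sum_const, card_univ, Fintype.card_fin, nsmul_eq_mul]; field_simp) n
  rw [sum_const, card_univ, Fintype.card_fin, nsmul_eq_mul] at h
  have heq : (1 : ℝ) / K * p = p / K := by ring
  rwa [heq] at h

/-- **`γ⋆ ≥ p/K`** for the refresh-then-propose star at uniform weights (`K ≥ 1`, `0 < p ≤ 1`, `|S| ≥ 1`). [ours] -/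
theorem refreshThenPropose_absSpectralGap_ge [Nonempty S] (hK : 1 ≤ K) (hμ : ∀ k x, 0 < μ k x) (hμ1 : ∀ k, ∑ u, μ k u = 1)
    (hp : 0 < p) (hp1 : p ≤ 1) (hdom : ∀ (k : Fin K) (u : S), p * μ k.succ (φ k u) ≤ μ 0 u) :
    p / K ≤ absSpectralGap (prodKernel (fun _ : Fin K => (1 : ℝ) / K)
      (fun k : Fin K => mhKernel (fun _ z : S => μ 0 ((φ k).symm z)) (μ k.succ))) := by
  have hKpos : (0 : ℝ) < K := Nat.cast_pos.mpr (by omega)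
  have hKr : (1 : ℝ) ≤ K := by exact_mod_cast hK
  have hρ0 : 0 ≤ 1 - p / K := by
    rw [sub_nonneg, div_le_one hKpos]; exact hp1.trans hKr
  -- stationarity of the product law
  have hq : ∀ k : Fin K, (∀ a b : S, 0 ≤ (fun _ z : S => μ 0 ((φ k).symm z)) a b) ∧
      (∀ a : S, ∑ b, (fun _ z : S => μ 0 ((φ k).symm z)) a b ≤ 1) := fun k =>
    ⟨fun _ z => (hμ 0 _).le, fun _ => by rw [Equiv.sum_comp (φ k).symm (μ 0)]; exact (hμ1 0).le⟩
  have hQ : IsRowStochastic (prodKernel (fun _ : Fin K => (1 : ℝ) / K)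
      (fun k : Fin K => mhKernel (fun _ z : S => μ 0 ((φ k).symm z)) (μ k.succ))) :=
    prodKernel_isRowStochastic _ _ (fun _ => by positivity)
      (by rw [sum_const, card_univ, Fintype.card_fin, nsmul_eq_mul]; field_simp)
      (fun k => mhKernel_isRowStochastic (hq k).1 (hq k).2 (hμ k.succ))
  have hst : IsStationary (tensorFun (fun k : Fin K => μ k.succ)) (prodKernel (fun _ : Fin K => (1 : ℝ) / K)
      (fun k : Fin K => mhKernel (fun _ z : S => μ 0 ((φ k).symm z)) (μ k.succ))) :=
    (prodKernel_detailedBalance (π := fun k : Fin K => μ k.succ) (fun k => mhKernel_detailedBalance (hμ k.succ) _) _).isStationary hQ.2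
  -- for every `δ > 0`: `d(n) ≤ K(1 − p/K + δ)ⁿ` with `1 − p/K + δ > 0`, so `γ⋆ ≥ p/K − δ`
  refine le_of_forall_pos_le_add fun δ hδ => ?_
  have hd : ∀ n : ℕ, worstTvDist (prodKernel (fun _ : Fin K => (1 : ℝ) / K)
      (fun k : Fin K => mhKernel (fun _ z : S => μ 0 ((φ k).symm z)) (μ k.succ))) (tensorFun (fun k : Fin K => μ k.succ)) n
        ≤ K * (1 - p / K + δ) ^ n := fun n =>
    (refreshThenPropose_worstTvDist_le_geom φ hK hμ hμ1 hp hp1 hdom n).trans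
      (mul_le_mul_of_nonneg_left (pow_le_pow_left₀ hρ0 (by linarith) n) hKpos.le)
  have h := absSpectralGap_ge_of_worstTvDist_le_geom hst (by linarith) hd
  linarith

/-- **`t_rel ≤ K/p`** for the refresh-then-propose star at uniform weights. [ours] -/
theorem refreshThenPropose_relaxationTime_le [Nonempty S] (hK : 1 ≤ K) (hμ : ∀ k x, 0 < μ k x) (hμ1 : ∀ k, ∑ u, μ k u = 1)
    (hp : 0 < p) (hp1 : p ≤ 1) (hdom : ∀ (k : Fin K) (u : S), p * μ k.succ (φ k u) ≤ μ 0 u) :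
    relaxationTime (prodKernel (fun _ : Fin K => (1 : ℝ) / K)
      (fun k : Fin K => mhKernel (fun _ z : S => μ 0 ((φ k).symm z)) (μ k.succ))) ≤ K / p := by
  have hKpos : (0 : ℝ) < K := Nat.cast_pos.mpr (by omega)
  have h := refreshThenPropose_absSpectralGap_ge φ hK hμ hμ1 hp hp1 hdom
  unfold relaxationTime
  calc 1 / absSpectralGap _ ≤ 1 / (p / K) := one_div_le_one_div_of_le (by positivity) h
    _ = K / p := one_div_div p K

/-- **`d(n₀) ≤ ε` at `n₀ = ⌈(K/p)·log(K/ε)⌉`** (uniform weights, `0 < ε`). [ours] -/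
theorem refreshThenPropose_worstTvDist_le_eps [Nonempty S] (hK : 1 ≤ K) (hμ : ∀ k x, 0 < μ k x) (hμ1 : ∀ k, ∑ u, μ k u = 1)
    (hp : 0 < p) (hp1 : p ≤ 1) (hdom : ∀ (k : Fin K) (u : S), p * μ k.succ (φ k u) ≤ μ 0 u) {ε : ℝ} (hε : 0 < ε) :
    worstTvDist (prodKernel (fun _ : Fin K => (1 : ℝ) / K) (fun k : Fin K => mhKernel (fun _ z : S => μ 0 ((φ k).symm z)) (μ k.succ)))
        (tensorFun (fun k : Fin K => μ k.succ)) ⌈(K : ℝ) / p * Real.log (K / ε)⌉₊ ≤ ε := by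
  have hKpos : (0 : ℝ) < K := Nat.cast_pos.mpr (by omega)
  have hKr : (1 : ℝ) ≤ K := by exact_mod_cast hK
  set n : ℕ := ⌈(K : ℝ) / p * Real.log (K / ε)⌉₊ with hn
  refine (refreshThenPropose_worstTvDist_le_geom φ hK hμ hμ1 hp hp1 hdom n).trans ?_
  have hθ0 : 0 ≤ 1 - p / (K : ℝ) := by rw [sub_nonneg, div_le_one hKpos]; exact hp1.trans hKr
  have hnge : (K : ℝ) / p * Real.log (K / ε) ≤ n := Nat.le_ceil _
  have hpow : (1 - p / (K : ℝ)) ^ n ≤ Real.exp (-(p / (K : ℝ) * n)) := by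
    calc (1 - p / (K : ℝ)) ^ n ≤ Real.exp (-(p / (K : ℝ))) ^ n :=
          pow_le_pow_left₀ hθ0 (by have := Real.one_sub_le_exp_neg (p / (K : ℝ)); linarith) n
      _ = Real.exp (-(p / (K : ℝ) * n)) := by rw [← Real.exp_nat_mul]; ring_nf
  have hexp : Real.exp (-(p / (K : ℝ) * n)) ≤ ε / K := by
    have h1 : Real.log (K / ε) ≤ p / (K : ℝ) * n := by
      have := mul_le_mul_of_nonneg_left hnge (by positivity : (0 : ℝ) ≤ p / K)
      rwa [← mul_assoc, show p / (K : ℝ) * (K / p) = 1 by field_simp, one_mul] at this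
    calc Real.exp (-(p / (K : ℝ) * n)) ≤ Real.exp (-Real.log (K / ε)) := Real.exp_le_exp.mpr (by linarith)
      _ = ε / K := by rw [Real.exp_neg, Real.exp_log (by positivity), inv_div]
  calc (K : ℝ) * (1 - p / (K : ℝ)) ^ n ≤ K * (ε / K) := mul_le_mul_of_nonneg_left (hpow.trans hexp) hKpos.le
    _ = ε := by field_simp

/-- **The refresh-then-propose star is irreducible** (its `⌈(K/p)·log(2K)⌉`-th power is entrywise positive). [ours] -/
theorem refreshThenPropose_isIrreducible [Nonempty S] (hK : 1 ≤ K) (hμ : ∀ k x, 0 < μ k x) (hμ1 : ∀ k, ∑ u, μ k u = 1)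
    (hp : 0 < p) (hp1 : p ≤ 1) (hdom : ∀ (k : Fin K) (u : S), p * μ k.succ (φ k u) ≤ μ 0 u) :
    Literature.Probability.MarkovChains.IsIrreducible (prodKernel (fun _ : Fin K => (1 : ℝ) / K)
      (fun k : Fin K => mhKernel (fun _ z : S => μ 0 ((φ k).symm z)) (μ k.succ))) := by
  have hKpos : (0 : ℝ) < K := Nat.cast_pos.mpr (by omega)
  have hKr : (1 : ℝ) ≤ K := by exact_mod_cast hK
  intro x y
  set n : ℕ := ⌈(K : ℝ) / p * Real.log (K / (1 / 2))⌉₊ with hn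
  refine ⟨n, ?_⟩
  have hq : ∀ k : Fin K, (∀ a b : S, 0 ≤ (fun _ z : S => μ 0 ((φ k).symm z)) a b) ∧
      (∀ a : S, ∑ b, (fun _ z : S => μ 0 ((φ k).symm z)) a b ≤ 1) := fun k =>
    ⟨fun _ z => (hμ 0 _).le, fun _ => by rw [Equiv.sum_comp (φ k).symm (μ 0)]; exact (hμ1 0).le⟩
  have hmin := prodKernel_pow_ge_tensorFun (X := fun _ : Fin K => S) (w := fun _ : Fin K => (1 : ℝ) / K) (β := fun _ => p)
    (π := fun k : Fin K => μ k.succ)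
    (fun k => mhKernel_isRowStochastic (hq k).1 (hq k).2 (hμ k.succ))
    (fun k => (mhKernel_detailedBalance (hμ k.succ) _).isStationary (mhKernel_isRowStochastic (hq k).1 (hq k).2 (hμ k.succ)).2)
    (fun k u => hμ k.succ u) (fun k => hμ1 k.succ) (fun _ => hp.le) (fun _ => hp1)
    (fun k u v => refreshThenPropose_minorized φ hμ hμ1 hp hdom k u v) (fun _ => by positivity)
    (by rw [sum_const, card_univ, Fintype.card_fin, nsmul_eq_mul]; field_simp) n x y
  rw [sum_const, card_univ, Fintype.card_fin, nsmul_eq_mul] at hmin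
  -- `K(1 − p/K)ⁿ ≤ 1/2 < 1`
  have hθ0 : 0 ≤ 1 - (1 : ℝ) / K * p := by
    rw [sub_nonneg, one_div, inv_mul_le_iff₀ hKpos, mul_one]; exact hp1.trans hKr
  have hnge : (K : ℝ) / p * Real.log (K / (1 / 2)) ≤ n := Nat.le_ceil _
  have hsmall : (K : ℝ) * (1 - (1 : ℝ) / K * p) ^ n ≤ 1 / 2 := by
    have hpow : (1 - (1 : ℝ) / K * p) ^ n ≤ Real.exp (-((1 : ℝ) / K * p * n)) := by
      calc (1 - (1 : ℝ) / K * p) ^ n ≤ Real.exp (-((1 : ℝ) / K * p)) ^ n :=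
            pow_le_pow_left₀ hθ0 (by have := Real.one_sub_le_exp_neg ((1 : ℝ) / K * p); linarith) n
        _ = Real.exp (-((1 : ℝ) / K * p * n)) := by rw [← Real.exp_nat_mul]; ring_nf
    have hexp : Real.exp (-((1 : ℝ) / K * p * n)) ≤ (1 / 2) / K := by
      have h1 : Real.log (K / (1 / 2)) ≤ (1 : ℝ) / K * p * n := by
        have := mul_le_mul_of_nonneg_left hnge (by positivity : (0 : ℝ) ≤ p / K)
        rw [← mul_assoc, show p / (K : ℝ) * (K / p) = 1 by field_simp, one_mul] at this
        calc Real.log (K / (1 / 2)) ≤ p / K * n := this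
          _ = (1 : ℝ) / K * p * n := by ring
      calc Real.exp (-((1 : ℝ) / K * p * n)) ≤ Real.exp (-Real.log (K / (1 / 2))) := Real.exp_le_exp.mpr (by linarith)
        _ = (1 / 2) / K := by rw [Real.exp_neg, Real.exp_log (by positivity), inv_div]
    calc (K : ℝ) * (1 - (1 : ℝ) / K * p) ^ n ≤ K * ((1 / 2) / K) := mul_le_mul_of_nonneg_left (hpow.trans hexp) hKpos.le
      _ = 1 / 2 := by field_simp
  have hπ : 0 < tensorFun (fun k : Fin K => μ k.succ) y := tensorFun_pos (fun k u => hμ k.succ u) y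
  exact lt_of_lt_of_le (by nlinarith) hmin

/-- **`Gap ≥ p/K`** (the variational spectral gap) for the refresh-then-propose star at uniform weights (`|S| ≥ 2`). [ours] -/
theorem refreshThenPropose_spectralGap_ge [Nontrivial S] (hK : 1 ≤ K) (hμ : ∀ k x, 0 < μ k x) (hμ1 : ∀ k, ∑ u, μ k u = 1)
    (hp : 0 < p) (hp1 : p ≤ 1) (hdom : ∀ (k : Fin K) (u : S), p * μ k.succ (φ k u) ≤ μ 0 u) :
    p / K ≤ spectralGap (tensorFun (fun k : Fin K => μ k.succ)) (prodKernel (fun _ : Fin K => (1 : ℝ) / K)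
      (fun k : Fin K => mhKernel (fun _ z : S => μ 0 ((φ k).symm z)) (μ k.succ))) := by
  haveI : Nonempty (Fin K) := ⟨⟨0, by omega⟩⟩
  have hq : ∀ k : Fin K, (∀ a b : S, 0 ≤ (fun _ z : S => μ 0 ((φ k).symm z)) a b) ∧
      (∀ a : S, ∑ b, (fun _ z : S => μ 0 ((φ k).symm z)) a b ≤ 1) := fun k =>
    ⟨fun _ z => (hμ 0 _).le, fun _ => by rw [Equiv.sum_comp (φ k).symm (μ 0)]; exact (hμ1 0).le⟩
  have hQ : IsRowStochastic (prodKernel (fun _ : Fin K => (1 : ℝ) / K)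
      (fun k : Fin K => mhKernel (fun _ z : S => μ 0 ((φ k).symm z)) (μ k.succ))) :=
    prodKernel_isRowStochastic _ _ (fun _ => by positivity)
      (by rw [sum_const, card_univ, Fintype.card_fin, nsmul_eq_mul]; field_simp)
      (fun k => mhKernel_isRowStochastic (hq k).1 (hq k).2 (hμ k.succ))
  have hDB : DetailedBalance (tensorFun (fun k : Fin K => μ k.succ)) (prodKernel (fun _ : Fin K => (1 : ℝ) / K)
      (fun k : Fin K => mhKernel (fun _ z : S => μ 0 ((φ k).symm z)) (μ k.succ))) :=
    prodKernel_detailedBalance (π := fun k : Fin K => μ k.succ) (fun k => mhKernel_detailedBalance (hμ k.succ) _) _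
  exact (refreshThenPropose_absSpectralGap_ge φ hK hμ hμ1 hp hp1 hdom).trans
    (absSpectralGap_le_spectralGap (fun z => tensorFun_pos (fun k u => hμ k.succ u) z)
      (sum_tensorFun_eq_one _ (fun k => hμ1 k.succ)) hQ hDB (refreshThenPropose_isIrreducible φ hK hμ hμ1 hp hp1 hdom))

/-- **THE REFRESH-THEN-PROPOSE RECIPE — HONEST SAMPLE SIZE FROM EVERY START, VOLUME-FREE AND POLYNOMIAL IN `K`:** burn-in
`r ≥ ⌈(K/p)·log(2K/ε)⌉`, run `N ≥ 1` with `N ≥ (4Var_π̃(f)/(η²ε))·(K/p)` ⇒ `P_x{|N⁻¹Σ_{s<N} f(X_{r+s}) − E_π̃ f| ≥ η} ≤ ε` (uniform weights,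
`|S| ≥ 2`). [ours] -/
theorem refreshThenPropose_timeAverage [Nontrivial S] (hK : 1 ≤ K) (hμ : ∀ k x, 0 < μ k x) (hμ1 : ∀ k, ∑ u, μ k u = 1)
    (hp : 0 < p) (hp1 : p ≤ 1) (hdom : ∀ (k : Fin K) (u : S), p * μ k.succ (φ k u) ≤ μ 0 u)
    (f : (Fin K → S) → ℝ) {ε η : ℝ} (hε : 0 < ε) (hη : 0 < η) {r N : ℕ}
    (hr : ⌈(K : ℝ) / p * Real.log (K / (ε / 2))⌉₊ ≤ r) (hN : 0 < N)
    (hNvar : 4 * lawVariance (tensorFun (fun k : Fin K => μ k.succ)) f / (η ^ 2 * ε) * (K / p) ≤ N) (x : Fin K → S) :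
    pathSum (prodKernel (fun _ : Fin K => (1 : ℝ) / K) (fun k : Fin K => mhKernel (fun _ z : S => μ 0 ((φ k).symm z)) (μ k.succ)))
      (N + r) x (fun ω =>
        if η ≤ |(∑ s : Fin N, f ((Matrix.vecCons x ω : Fin (N + r + 1) → (Fin K → S))
              ⟨(s : ℕ) + r, by have := s.isLt; omega⟩)) / N - lawMean (tensorFun (fun k : Fin K => μ k.succ)) f|
          then (1 : ℝ) else 0) ≤ ε := by
  haveI : Nonempty (Fin K) := ⟨⟨0, by omega⟩⟩
  have hKpos : (0 : ℝ) < K := Nat.cast_pos.mpr (by omega)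
  have hq : ∀ k : Fin K, (∀ a b : S, 0 ≤ (fun _ z : S => μ 0 ((φ k).symm z)) a b) ∧
      (∀ a : S, ∑ b, (fun _ z : S => μ 0 ((φ k).symm z)) a b ≤ 1) := fun k =>
    ⟨fun _ z => (hμ 0 _).le, fun _ => by rw [Equiv.sum_comp (φ k).symm (μ 0)]; exact (hμ1 0).le⟩
  have hQ : IsRowStochastic (prodKernel (fun _ : Fin K => (1 : ℝ) / K)
      (fun k : Fin K => mhKernel (fun _ z : S => μ 0 ((φ k).symm z)) (μ k.succ))) :=
    prodKernel_isRowStochastic _ _ (fun _ => by positivity)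
      (by rw [sum_const, card_univ, Fintype.card_fin, nsmul_eq_mul]; field_simp)
      (fun k => mhKernel_isRowStochastic (hq k).1 (hq k).2 (hμ k.succ))
  have hDB : DetailedBalance (tensorFun (fun k : Fin K => μ k.succ)) (prodKernel (fun _ : Fin K => (1 : ℝ) / K)
      (fun k : Fin K => mhKernel (fun _ z : S => μ 0 ((φ k).symm z)) (μ k.succ))) :=
    prodKernel_detailedBalance (π := fun k : Fin K => μ k.succ) (fun k => mhKernel_detailedBalance (hμ k.succ) _) _
  have hirr := refreshThenPropose_isIrreducible φ hK hμ hμ1 hp hp1 hdom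
  have hε2 : 0 < ε / 2 := by linarith
  have ht₀ := refreshThenPropose_worstTvDist_le_eps φ hK hμ hμ1 hp hp1 hdom hε2
  have hmix : mixingTime (prodKernel (fun _ : Fin K => (1 : ℝ) / K)
      (fun k : Fin K => mhKernel (fun _ z : S => μ 0 ((φ k).symm z)) (μ k.succ))) (tensorFun (fun k : Fin K => μ k.succ)) (ε / 2)
        ≤ r := (mixingTime_le _ _ ht₀).trans hr
  have hgap := refreshThenPropose_spectralGap_ge φ hK hμ hμ1 hp hp1 hdom
  have hG0 : 0 < p / K := by positivity
  have hγinv : (spectralGap (tensorFun (fun k : Fin K => μ k.succ)) (prodKernel (fun _ : Fin K => (1 : ℝ) / K)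
      (fun k : Fin K => mhKernel (fun _ z : S => μ 0 ((φ k).symm z)) (μ k.succ))))⁻¹ ≤ K / p := by
    calc _ ≤ (p / K)⁻¹ := by rw [inv_le_inv₀ (hG0.trans_le hgap) hG0]; exact hgap
      _ = K / p := by rw [inv_div]
  have hV : 0 ≤ 4 * lawVariance (tensorFun (fun k : Fin K => μ k.succ)) f / (η ^ 2 * ε) :=
    div_nonneg (mul_nonneg (by norm_num) (lawVariance_nonneg (fun z => (tensorFun_pos (fun k u => hμ k.succ u) z).le) f))
      (by positivity)
  exact LevinPeres2017_thm_12_21 (fun z => tensorFun_pos (fun k u => hμ k.succ u) z) (sum_tensorFun_eq_one _ (fun k => hμ1 k.succ))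
    hQ hDB hirr f hε hη ht₀ hmix hN ((mul_le_mul_of_nonneg_left hγinv hV).trans hNvar) x

end Refresh

end Summit.Ventures.LatticeQCDFlow.Scaling

end
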